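/-
Copyright (c) 2026. All rights reserved.
Released under Apache 2.0 license as described in the file LICENSE.
Authors: abc-iut cell, prover seat abc-iut-f-102 (F fact-proving wave, gen 3/4).
-/
import Literature.AnabelianGeometry.AbsoluteAnabelian.LogFrobeniusRealisesOverGenerators
import Literature.AnabelianGeometry.AbsoluteAnabelian.LogFrobeniusShiftActionIotaIsoPostLog
import Literature.AnabelianGeometry.AbsoluteAnabelian.LogFrobeniusShiftActionOfRealises
import HarnessLib

/-!
# [AbsTopIII] Cor 5.5 (i)/(iii): THEOREM B, NECESSITY — a realising family forces the `ι⊞` to lie over `Th•[Z]`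

S. Mochizuki, *Topics in absolute anabelian geometry III: global reconstruction algorithms*,
J. Math. Sci. Univ. Tokyo 22 (2015) 939–1156 [MochizukiAbsTopIII2015]; locators `p.N` = pages of the author's
manuscript (`paper:url-5493eb38cbb7`), read on the page: Cor 5.5 (i) p. 130, (iii) p. 131, Def 5.4 (iv) pp. 126–127, (vii)
p. 128, Def 3.5 (ii)/(iii) p. 75.

THEOREM B of the f-102 lineage, NECESSITY half (converse of `LogFrobeniusRealisesSufficiency.lean`): if ONE family of
homotopies `K` on `D•⊢` realises the cores of Cor 5.5 (i) and the observables `S_log⊞_v` of Cor 5.5 (iii)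
(`RealisesCor55Families K`, FACT-LIST F-0159), then the `ι⊞_{v,ε}` LIE OVER `Th•[Z]` with respect to SOME over-data: the
core homotopies of `K` (invertible, Def 3.5 (iii)) give `A_ν : λ⊞_{v,ν} ⋙ (𝒩⊞_v → ℰ•) ≅ proj` (`overA`, through a reference
place `v₀` and the interface's `lamOver` there) and `Ξ : log ⋙ proj ≅ proj` (`overΞ`), and the whiskering axiom of Def 3.5
(ii) applied to the observable pairs (gen 0's `exists_η_obsPair_eq_iota(_postLog)`) yields exactly the hypotheses Pre/Post
of the sufficiency theorem (`overA_pre`, `overA_post`, packaged as `exists_over_of_realisesCor55Families`).  Together with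
sufficiency: F-0159 (hence F-0157, F-0156) is EQUIVALENT, over a nonempty index set, to «`ι⊞`-squares commute ∧ the `ι⊞` lie
over `Th•[Z]` for some over-data».  No claim of the paper is asserted; refereed pre-IUT material; nothing here bears on
[IUTchIII] Cor. 3.12; typed ≠ proved.
-/

set_option autoImplicit false

universe u

open CategoryTheory Quiver

namespace Literature.AnabelianGeometry.AbsoluteAnabelian

section HEqLemmas

/-- A functor maps heterogeneously equal morphisms to heterogeneously equal morphisms. [folklore] -/
private theorem map_heq_of_heq' {C D : Type*} [Category C] [Category D] (F : C ⥤ D) {a a' b b' : C} (ha : a = a')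
    (hb : b = b') {f : a ⟶ b} {g : a' ⟶ b'} (h : f ≍ g) : F.map f ≍ F.map g := by
  subst ha hb
  cases h
  rfl

/-- Components of natural transformations at equal objects. [folklore] -/
private theorem app_heq_of_eq' {C D : Type*} [Category C] [Category D] {F G : C ⥤ D} (α : F ⟶ G) {x y : C} (h : x = y) :
    α.app x ≍ α.app y := by
  subst h
  rfl

/-- Components of heterogeneously equal natural transformations. [folklore] -/
private theorem app_heq_of_heq' {C D : Type*} [Category C] [Category D] {F G F' G' : C ⥤ D} (hF : F = F') (hG : G = G')
    {α : F ⟶ G} {β : F' ⟶ G'} (h : α ≍ β) (x : C) : α.app x ≍ β.app x := by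
  subst hF hG
  cases h
  rfl

/-- Three heterogeneously equal factors interleaved with `eqToHom`s compose to the plain composite (free endpoints).
[folklore] -/
private theorem heq_comp₃_of_heq {C : Type*} [Category C] {a₀ a₁ b₁ c₁ a₂ b₂ c₂ a₃ b₃ b₀ x y z w : C}
    (e₁ : a₀ = a₁) {α₁ : a₁ ⟶ b₁} (e₂ : b₁ = c₁) (e₃ : c₁ = a₂) {α₂ : a₂ ⟶ b₂} (e₄ : b₂ = c₂) (e₅ : c₂ = a₃)
    {α₃ : a₃ ⟶ b₃} (e₆ : b₃ = b₀) {β₁ : x ⟶ y} {β₂ : y ⟶ z} {β₃ : z ⟶ w} (ha₁ : a₁ = x) (hb₁ : b₁ = y) (ha₂ : a₂ = y)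
    (hb₂ : b₂ = z) (ha₃ : a₃ = z) (hb₃ : b₃ = w) (h₁ : α₁ ≍ β₁) (h₂ : α₂ ≍ β₂) (h₃ : α₃ ≍ β₃) :
    eqToHom e₁ ≫ α₁ ≫ eqToHom e₂ ≫ eqToHom e₃ ≫ α₂ ≫ eqToHom e₄ ≫ eqToHom e₅ ≫ α₃ ≫ eqToHom e₆ ≍ β₁ ≫ β₂ ≫ β₃ := by
  subst ha₁ hb₁ ha₂ hb₂ ha₃ hb₃
  cases h₁; cases h₂; cases h₃
  cases e₁; cases e₆
  simp

/-- As `heq_comp₃_of_heq`, with two cancelling iso-components interleaved (the shape met below). [folklore] -/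
private theorem heq_comp₃_of_heq' {C : Type*} [Category C] {a₀ a₁ b₁ c₁ m₁ a₂ b₂ c₂ m₂ a₃ b₃ b₀ x y z w : C}
    (e₁ : a₀ = a₁) {α₁ : a₁ ⟶ b₁} (e₂ : b₁ = c₁) {H₁ : c₁ ⟶ m₁} {I₁ : m₁ ⟶ c₁} (e₃ : c₁ = a₂) {α₂ : a₂ ⟶ b₂}
    (e₄ : b₂ = c₂) {H₂ : c₂ ⟶ m₂} {I₂ : m₂ ⟶ c₂} (e₅ : c₂ = a₃) {α₃ : a₃ ⟶ b₃} (e₆ : b₃ = b₀) {β₁ : x ⟶ y}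
    {β₂ : y ⟶ z} {β₃ : z ⟶ w} (hHI₁ : H₁ ≫ I₁ = 𝟙 _) (hHI₂ : H₂ ≫ I₂ = 𝟙 _) (ha₁ : a₁ = x) (hb₁ : b₁ = y)
    (ha₂ : a₂ = y) (hb₂ : b₂ = z) (ha₃ : a₃ = z) (hb₃ : b₃ = w) (h₁ : α₁ ≍ β₁) (h₂ : α₂ ≍ β₂) (h₃ : α₃ ≍ β₃) :
    eqToHom e₁ ≫ α₁ ≫ eqToHom e₂ ≫ H₁ ≫ ((I₁ ≫ eqToHom e₃ ≫ α₂ ≫ eqToHom e₄ ≫ H₂) ≫ I₂ ≫ eqToHom e₅ ≫ α₃ ≫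
      eqToHom e₆) ≍ β₁ ≫ β₂ ≫ β₃ := by
  subst ha₁ hb₁ ha₂ hb₂ ha₃ hb₃
  cases h₁; cases h₂; cases h₃
  cases e₁; cases e₆; cases e₂; cases e₅
  simp [reassoc_of% hHI₁, reassoc_of% hHI₂]

end HEqLemmas

namespace LogFrobeniusSetting

variable {Vmod : Type u} {isArc : Vmod → Bool} (L : LogFrobeniusSetting Vmod isArc) {K : L.diagram.HomotopyFamily}

/-- The homotopies of one family at (propositionally) equal pairs agree. [cite: MochizukiAbsTopIII2015, Definition 3.5 (ii) p.75] -/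
theorem η_heq_of_pair_eq (K : L.diagram.HomotopyFamily) {a b : DVertex Vmod isArc} {p p' q q' : Path a b}
    (hp : p = p') (hq : q = q') (h : K.E p q) (h' : K.E p' q') : K.η h ≍ K.η h' := by
  subst hp hq
  rfl

/-- `ℰ•` is not in the first four rows. [cite: MochizukiAbsTopIII2015, Cor 5.5 p. 130] -/
theorem e5_not_inFirstRows_four : ¬ (DVertex.e5 : DVertex Vmod isArc).InFirstRows 4 :=
  fun h => absurd h.2 (by simp [DVertex.row])

/-- the sources of the arrows into `ℰ•` lie in the first four rows. [cite: MochizukiAbsTopIII2015, Cor 5.5 p. 130] -/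
theorem inFirstRows_four_of_hom_e5 {c : DVertex Vmod isArc} (e : c ⟶ DVertex.e5) : c.InFirstRows 4 := by
  cases e
  exact ⟨trivial, by simp [DVertex.row]⟩

/-- `□ ∈ D•_{≤4}`. [cite: MochizukiAbsTopIII2015, Cor 5.5 p. 130] -/
theorem core_inFirstRows_four : (DVertex.core : DVertex Vmod isArc).InFirstRows 4 := ⟨trivial, by simp [DVertex.row]⟩

/-- `𝒳_m ∈ D•_{≤4}`. [cite: MochizukiAbsTopIII2015, Cor 5.5 p. 130] -/
theorem row1_inFirstRows_four (m : ℤ) : (DVertex.row1 m : DVertex Vmod isArc).InFirstRows 4 :=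
  ⟨trivial, by simp [DVertex.row]⟩

/-- **All co-verticial pairs of paths of `Γ⃗_{D•⊢}` from `D•_{≤4}` into `ℰ•` are boundary pairs of a realising family** (the core
of Cor 5.5 (i) embedded in `K`; gen 2's `E_of_isCoreOnIn`). [cite: MochizukiAbsTopIII2015, Definition 3.5 (iii) pp.75–76] -/
theorem E_e5_of_realises (hK : L.RealisesCor55Families K) {a : DVertex Vmod isArc} (ha : a.InFirstRows 4)
    (p q : Path a DVertex.e5) : K.E p q :=
  L.E_of_isCoreOnIn hK.1 e5_not_inFirstRows_four DVertex.inFirstRows_of_hom inFirstRows_four_of_hom_e5 ha p q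

/-- **The core homotopies are invertible**: the isomorphism `D•⊢_[p] ≅ D•⊢_[q]` of a realising family between any two
co-verticial paths from `D•_{≤4}` into `ℰ•` (Def 3.5 (iii): a core is symmetric). [cite: MochizukiAbsTopIII2015, Definition 3.5 (iii) p.75] -/
noncomputable def coreIso (hK : L.RealisesCor55Families K) {a : DVertex Vmod isArc} (ha : a.InFirstRows 4)
    (p q : Path a DVertex.e5) : L.diagram.pathFunctor p ≅ L.diagram.pathFunctor q where
  hom := K.η (L.E_e5_of_realises hK ha p q)
  inv := K.η (L.E_e5_of_realises hK ha q p)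
  hom_inv_id := by rw [← K.η_trans]; exact K.η_refl _
  inv_hom_id := by rw [← K.η_trans]; exact K.η_refl _

/-- For a pre-log `ν`, `λ⊞_ν ⋙ (𝒩⊞_v → ℰ•)` is the path functor of `[λ⊞_ν]∘[forget]∘[toE]`.
[cite: MochizukiAbsTopIII2015, Def 5.4 (vii) p. 128] -/
theorem lam_forget_toE_eq_pathFunctor (v : Vmod) (ν : LogVertex (isArc v)) (hν : ν.isPostLog = false) :
    L.lam v ν ⋙ L.forget v ⋙ L.toE v = L.diagram.pathFunctor ((lamP v ν hν).comp (ftP v)) := by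
  rw [pathFunctor_lamP_comp_ftP, hν]
  rfl

/-- **The over-datum `A` extracted from a realising family**: `λ⊞_{v,ν} ⋙ (𝒩⊞_v → ℰ•) ≅ proj` through the core homotopy to
the reference path `[λ⊞_{v₀,sl}]∘[forget]∘[toE]` and the interface's `lamOver` there.
[cite: MochizukiAbsTopIII2015, Cor 5.5 (i) p. 130] -/
noncomputable def overA (hK : L.RealisesCor55Families K) (v₀ : Vmod) (v : Vmod) (ν : LogVertex (isArc v))
    (hν : ν.isPostLog = false) : L.lam v ν ⋙ L.forget v ⋙ L.toE v ≅ L.proj :=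
  eqToIso (L.lam_forget_toE_eq_pathFunctor v ν hν) ≪≫
    L.coreIso hK core_inFirstRows_four ((lamP v ν hν).comp (ftP v))
      ((lamP v₀ (LogVertex.spaceLink (isArc v₀)) (spaceLink_isPostLog _)).comp (ftP v₀)) ≪≫
    eqToIso (L.lam_forget_toE_eq_pathFunctor v₀ _ (spaceLink_isPostLog _)).symm ≪≫
    L.lamOver v₀ (LogVertex.spaceLink (isArc v₀))

/-- **The pre-log `ι⊞_{v,ε}` lie over `Th•[Z]` w.r.t. the extracted over-datum** (necessity, pre-log half).
[cite: MochizukiAbsTopIII2015, Cor 5.5 (iii) p. 131] -/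
theorem overA_pre (hK : L.RealisesCor55Families K) (v₀ : Vmod) (v : Vmod) (ν₁ ν₂ : LogVertex (isArc v))
    (ε : LogEdge (isArc v) ν₁ ν₂) (h₁ : ν₁.isPostLog = false) (h₂ : ν₂.isPostLog = false) (X₀ : L.X) :
    (L.toE v).map ((L.forget v).map ((L.iota v ε).app X₀)) ≍
      ((L.overA hK v₀ v ν₁ h₁).hom.app X₀ ≫ (L.overA hK v₀ v ν₂ h₂).inv.app X₀) := by
  have h₁₂ := L.E_e5_of_realises hK core_inFirstRows_four ((lamP v ν₁ h₁).comp (ftP v)) ((lamP v ν₂ h₂).comp (ftP v))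
  have hR : (L.overA hK v₀ v ν₁ h₁).hom.app X₀ ≫ (L.overA hK v₀ v ν₂ h₂).inv.app X₀ =
      eqToHom (Functor.congr_obj (L.lam_forget_toE_eq_pathFunctor v ν₁ h₁) X₀) ≫ (K.η h₁₂).app X₀ ≫
        eqToHom (Functor.congr_obj (L.lam_forget_toE_eq_pathFunctor v ν₂ h₂) X₀).symm := by
    simp only [overA, coreIso, Iso.trans_hom, Iso.trans_inv, eqToIso.hom, eqToIso.inv,
      NatTrans.comp_app, eqToHom_app, Category.assoc, Iso.hom_inv_id_app_assoc, eqToHom_trans_assoc, eqToHom_refl,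
      Category.id_comp]
    erw [← NatTrans.comp_app_assoc, ← K.η_trans]
  rw [hR]
  refine HEq.trans ?_ (DiagramOfCategories.HomotopyFamily.heq_eqToHom_comp_comp_eqToHom _ _ _).symm
  -- the observable pair `([λ⊞_{ν₁}], [λ⊞_{ν₂}])`, whiskered by `[forget]∘[toE]`
  obtain ⟨k₁, hk₁⟩ := L.exists_η_obsPair_eq_iota v (hK.2.2.2 v) ε h₁ h₂
  have hw := K.η_whisker k₁ Path.nil (ftP v)
  have hy : (L.diagram.pathFunctor (Path.nil : Path (DVertex.core : DVertex Vmod isArc) .core)).obj X₀ = X₀ :=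
    Functor.congr_obj (L.diagram.pathFunctor_nil DVertex.core) X₀
  obtain ⟨e₁, e₂, hkapp⟩ := hk₁ ((L.diagram.pathFunctor (Path.nil : Path (DVertex.core : DVertex Vmod isArc) .core)).obj X₀)
  -- `(K.η h₁₂).app X₀ ≍ ((𝒩⊞_v → ℰ•))(ι⊞_{v,ε,X₀})`
  symm
  refine (app_heq_of_heq' (congrArg L.diagram.pathFunctor (Path.nil_comp _).symm)
    (congrArg L.diagram.pathFunctor (Path.nil_comp _).symm)
    (L.η_heq_of_pair_eq K (Path.nil_comp _).symm (Path.nil_comp _).symm h₁₂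
      (K.isSaturated.precomp (K.isSaturated.postcomp k₁ (ftP v)) Path.nil)) X₀).trans ?_
  erw [hw]
  simp only [NatTrans.comp_app, eqToHom_app, Functor.whiskerLeft_app, Functor.whiskerRight_app]
  refine (eqToHom_comp_heq _ _).trans ((comp_eqToHom_heq _ _).trans ?_)
  refine (Functor.hcongr_hom (L.pathFunctor_ftP v) _).trans ?_
  rw [hkapp]
  exact map_heq_of_heq' (L.forget v ⋙ L.toE v)
    ((congrArg (fun z => (L.diagram.pathFunctor (lamP v ν₁ h₁)).obj z) hy).trans
      (Functor.congr_obj (L.pathFunctor_lamP v ν₁ h₁) X₀))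
    ((congrArg (fun z => (L.diagram.pathFunctor (lamP v ν₂ h₂)).obj z) hy).trans
      (Functor.congr_obj (L.pathFunctor_lamP' v ν₂ h₂) X₀).symm)
    ((DiagramOfCategories.HomotopyFamily.heq_eqToHom_comp_comp_eqToHom _ _ _).trans (app_heq_of_eq' (L.iota v ε) hy))

/-! ## The post-log half -/

/-- `log ⋙ λ⊞_{sl} ⋙ (𝒩⊞_v → ℰ•)` is the path functor of `[log]∘[id_0]∘[λ⊞_{sl}]∘[forget]∘[toE]`.
[cite: MochizukiAbsTopIII2015, Def 5.4 (vii) p. 128] -/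
theorem log_lam_forget_toE_eq_pathFunctor (v : Vmod) (hsl : (LogVertex.spaceLink (isArc v)).isPostLog = false) :
    L.log ⋙ (L.lam v (LogVertex.spaceLink (isArc v)) ⋙ L.forget v ⋙ L.toE v) =
      L.diagram.pathFunctor ((postDomP v 0 hsl).comp (ftP v)) := by
  rw [DiagramOfCategories.pathFunctor_comp, pathFunctor_ftP, postDomP, DiagramOfCategories.pathFunctor_cons,
    DiagramOfCategories.pathFunctor_cons, DiagramOfCategories.pathFunctor_cons, DiagramOfCategories.pathFunctor_nil]
  rfl

/-- `λ⊞_{ν₂} ⋙ (𝒩⊞_v → ℰ•)` is the path functor of `[id_1]∘[λ⊞_{ν₂}]∘[forget]∘[toE]`. [cite: MochizukiAbsTopIII2015, Def 5.4 (vii) p. 128] -/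
theorem lam_forget_toE_eq_pathFunctor_cod (v : Vmod) (ν₂ : LogVertex (isArc v)) (h₂ : ν₂.isPostLog = false) :
    L.lam v ν₂ ⋙ L.forget v ⋙ L.toE v = L.diagram.pathFunctor ((postCodP v 0 ν₂ h₂).comp (ftP v)) := by
  rw [DiagramOfCategories.pathFunctor_comp, pathFunctor_ftP, postCodP, DiagramOfCategories.pathFunctor_cons,
    DiagramOfCategories.pathFunctor_cons, DiagramOfCategories.pathFunctor_nil]
  rfl

/-- **The over-datum `Ξ : log ⋙ proj ≅ proj` extracted from a realising family**: the core homotopy between the whiskered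
post-log generator paths at the reference place, conjugated by `lamOver`. [cite: MochizukiAbsTopIII2015, Cor 5.5 (i) p. 130] -/
noncomputable def overΞ (hK : L.RealisesCor55Families K) (v₀ : Vmod) : L.log ⋙ L.proj ≅ L.proj :=
  (Functor.isoWhiskerLeft L.log (L.lamOver v₀ (LogVertex.spaceLink (isArc v₀)))).symm ≪≫
    eqToIso (L.log_lam_forget_toE_eq_pathFunctor v₀ (spaceLink_isPostLog _)) ≪≫
    L.coreIso hK (row1_inFirstRows_four 1) ((postDomP v₀ 0 (spaceLink_isPostLog _)).comp (ftP v₀))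
      ((postCodP v₀ 0 (LogVertex.spaceLink (isArc v₀)) (spaceLink_isPostLog _)).comp (ftP v₀)) ≪≫
    eqToIso (L.lam_forget_toE_eq_pathFunctor_cod v₀ _ (spaceLink_isPostLog _)).symm ≪≫
    L.lamOver v₀ (LogVertex.spaceLink (isArc v₀))

/-- A core homotopy out of `□`, whiskered on the left by a path `r : 𝒳_1 ⟶ □` and evaluated, is (heterogeneously) the
homotopy evaluated at the image object. [cite: MochizukiAbsTopIII2015, Definition 3.5 (ii) p.75] -/
theorem η_precomp_app_heq (hK : L.RealisesCor55Families K)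
    (r : Path (DVertex.row1 (0 + 1) : DVertex Vmod isArc) .core) (p q : Path (DVertex.core : DVertex Vmod isArc) .e5)
    (X₀ : L.X) {y : L.X} (hy : (L.diagram.pathFunctor r).obj X₀ = y) :
    (K.η (L.E_e5_of_realises hK (row1_inFirstRows_four (0 + 1)) (r.comp p) (r.comp q))).app X₀ ≍
      (K.η (L.E_e5_of_realises hK core_inFirstRows_four p q)).app y := by
  have hw := K.η_whisker (L.E_e5_of_realises hK core_inFirstRows_four p q) r Path.nil
  refine (app_heq_of_heq' rfl rfl (L.η_heq_of_pair_eq K rfl rfl _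
    (K.isSaturated.precomp (K.isSaturated.postcomp (L.E_e5_of_realises hK core_inFirstRows_four p q) Path.nil) r))
    X₀).trans ?_
  rw [hw]
  simp only [NatTrans.comp_app, eqToHom_app, Functor.whiskerLeft_app, Functor.whiskerRight_app]
  refine (eqToHom_comp_heq _ _).trans ((comp_eqToHom_heq _ _).trans ?_)
  refine (Functor.hcongr_hom (L.diagram.pathFunctor_nil DVertex.e5) _).trans ?_
  exact app_heq_of_eq' _ hy

/-- **The post-log `ι⊞_{v,ε}` lie over `Th•[Z]` w.r.t. the extracted over-data** (necessity, post-log half).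
[cite: MochizukiAbsTopIII2015, Cor 5.5 (iii) p. 131] -/
theorem overA_post (hK : L.RealisesCor55Families K) (v₀ : Vmod) (v : Vmod) (ν₁ ν₂ : LogVertex (isArc v))
    (ε : LogEdge (isArc v) ν₁ ν₂) (h₁ : ν₁.isPostLog = true) (h₂ : ν₂.isPostLog = false)
    (hsl : (LogVertex.spaceLink (isArc v)).isPostLog = false) (X₀ : L.X) :
    (L.toE v).map ((L.forget v).map ((L.iota v ε).app X₀)) ≍
      ((L.overA hK v₀ v _ hsl).hom.app (L.log.obj X₀) ≫ (L.overΞ hK v₀).hom.app X₀ ≫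
        (L.overA hK v₀ v ν₂ h₂).inv.app X₀) := by
  have hsl₀ := spaceLink_isPostLog (isArc v₀)
  have hQ := L.E_e5_of_realises hK (row1_inFirstRows_four 1) ((postDomP v 0 hsl).comp (ftP v))
    ((postCodP v 0 ν₂ h₂).comp (ftP v))
  -- (a) the whiskered post-log pair carries `ι⊞ ▷ (𝒩⊞_v → ℰ•)`
  have ha : (K.η hQ).app X₀ ≍ (L.toE v).map ((L.forget v).map ((L.iota v ε).app X₀)) := by
    obtain ⟨k₁, hk₁⟩ := L.exists_η_obsPair_eq_iota_postLog v (hK.2.2.2 v) ε h₁ h₂ hsl 0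
    have hw := K.η_whisker k₁ Path.nil (ftP v)
    have hy : (L.diagram.pathFunctor
        (Path.nil : Path (DVertex.row1 (0 + 1) : DVertex Vmod isArc) (.row1 (0 + 1)))).obj X₀ = X₀ :=
      Functor.congr_obj (L.diagram.pathFunctor_nil (DVertex.row1 (0 + 1))) X₀
    obtain ⟨e₁, e₂, hkapp⟩ := hk₁ ((L.diagram.pathFunctor
      (Path.nil : Path (DVertex.row1 (0 + 1) : DVertex Vmod isArc) (.row1 (0 + 1)))).obj X₀)
    refine (app_heq_of_heq' (congrArg L.diagram.pathFunctor (Path.nil_comp _).symm)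
      (congrArg L.diagram.pathFunctor (Path.nil_comp _).symm)
      (L.η_heq_of_pair_eq K (Path.nil_comp _).symm (Path.nil_comp _).symm hQ
        (K.isSaturated.precomp (K.isSaturated.postcomp k₁ (ftP v)) Path.nil)) X₀).trans ?_
    erw [hw]
    simp only [NatTrans.comp_app, eqToHom_app, Functor.whiskerLeft_app, Functor.whiskerRight_app]
    refine (eqToHom_comp_heq _ _).trans ((comp_eqToHom_heq _ _).trans ?_)
    refine (Functor.hcongr_hom (L.pathFunctor_ftP v) _).trans ?_
    rw [hkapp]
    exact map_heq_of_heq' (L.forget v ⋙ L.toE v)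
      ((congrArg (fun z => (L.diagram.pathFunctor (postDomP v 0 hsl)).obj z) hy).trans
        (Functor.congr_obj (L.pathFunctor_postDomP v ν₁ h₁ 0 hsl) X₀))
      ((congrArg (fun z => (L.diagram.pathFunctor (postCodP v 0 ν₂ h₂)).obj z) hy).trans
        (Functor.congr_obj (L.pathFunctor_postCodP v 0 ν₂ h₂) X₀).symm)
      ((DiagramOfCategories.HomotopyFamily.heq_eqToHom_comp_comp_eqToHom _ _ _).trans (app_heq_of_eq' (L.iota v ε) hy))
  -- (b) the right-hand side is the same core homotopy, by transitivity through the reference place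
  have hD := L.E_e5_of_realises hK (row1_inFirstRows_four 1) ((postDomP v 0 hsl).comp (ftP v))
    ((postDomP v₀ 0 hsl₀).comp (ftP v₀))
  have hΞ := L.E_e5_of_realises hK (row1_inFirstRows_four 1) ((postDomP v₀ 0 hsl₀).comp (ftP v₀))
    ((postCodP v₀ 0 (LogVertex.spaceLink (isArc v₀)) hsl₀).comp (ftP v₀))
  have hC := L.E_e5_of_realises hK (row1_inFirstRows_four 1)
    ((postCodP v₀ 0 (LogVertex.spaceLink (isArc v₀)) hsl₀).comp (ftP v₀)) ((postCodP v 0 ν₂ h₂).comp (ftP v))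
  have htrans : (K.η hD).app X₀ ≫ (K.η hΞ).app X₀ ≫ (K.η hC).app X₀ = (K.η hQ).app X₀ := by
    erw [← NatTrans.comp_app, ← NatTrans.comp_app, ← K.η_trans, ← K.η_trans]
  have hylog : (L.diagram.pathFunctor ((Path.nil.cons (DEdge.log 0)).cons (DEdge.toCore 0) :
      Path (DVertex.row1 (0 + 1) : DVertex Vmod isArc) .core)).obj X₀ = L.log.obj X₀ := by
    simp only [DiagramOfCategories.pathFunctor_cons, DiagramOfCategories.pathFunctor_nil, Functor.comp_obj,
      Functor.id_obj]
    rfl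
  have hyid : (L.diagram.pathFunctor (Path.nil.cons (DEdge.toCore (0 + 1)) :
      Path (DVertex.row1 (0 + 1) : DVertex Vmod isArc) .core)).obj X₀ = X₀ := by
    simp only [DiagramOfCategories.pathFunctor_cons, DiagramOfCategories.pathFunctor_nil, Functor.comp_obj,
      Functor.id_obj]
    rfl
  have hb : (L.overA hK v₀ v _ hsl).hom.app (L.log.obj X₀) ≫ (L.overΞ hK v₀).hom.app X₀ ≫
      (L.overA hK v₀ v ν₂ h₂).inv.app X₀ ≍ (K.η hD).app X₀ ≫ (K.η hΞ).app X₀ ≫ (K.η hC).app X₀ := by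
    simp only [overA, overΞ, coreIso, Iso.trans_hom, Iso.trans_inv, eqToIso.hom, eqToIso.inv, Iso.symm_hom,
      Functor.isoWhiskerLeft_inv, Functor.whiskerLeft_app, NatTrans.comp_app, eqToHom_app, Category.assoc]
    refine heq_comp₃_of_heq' _ _ _ _ _ _ (Iso.hom_inv_id_app _ _) (Iso.hom_inv_id_app _ _) ?_ ?_ rfl rfl ?_ ?_ ?_
      HEq.rfl ?_
    · exact (L.pathFunctor_lamP_comp_ftP_obj v _ hsl (L.log.obj X₀)).trans
        (L.pathFunctor_postDomP_comp_ftP_obj v 0 hsl X₀).symm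
    · exact (L.pathFunctor_lamP_comp_ftP_obj v₀ _ hsl₀ (L.log.obj X₀)).trans
        (L.pathFunctor_postDomP_comp_ftP_obj v₀ 0 hsl₀ X₀).symm
    · exact (L.pathFunctor_lamP_comp_ftP_obj v₀ _ hsl₀ X₀).trans (L.pathFunctor_postCodP_comp_ftP_obj v₀ 0 _ hsl₀ X₀).symm
    · exact (L.pathFunctor_lamP_comp_ftP_obj v ν₂ h₂ X₀).trans (L.pathFunctor_postCodP_comp_ftP_obj v 0 ν₂ h₂ X₀).symm
    · exact (L.η_precomp_app_heq hK ((Path.nil.cons (DEdge.log 0)).cons (DEdge.toCore 0))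
        ((lamP v _ hsl).comp (ftP v)) ((lamP v₀ _ hsl₀).comp (ftP v₀)) X₀ hylog).symm
    · exact (L.η_precomp_app_heq hK (Path.nil.cons (DEdge.toCore (0 + 1)))
        ((lamP v₀ _ hsl₀).comp (ftP v₀)) ((lamP v ν₂ h₂).comp (ftP v)) X₀ hyid).symm
  exact ((hb.trans (heq_of_eq htrans)).trans ha).symm

/-- **THEOREM B, NECESSITY**: a family realising Cor 5.5 (i)/(iii) yields over-data `A`, `Ξ` with respect to which every
`ι⊞_{v,ε}` lies over `Th•[Z]` — exactly the hypotheses of `exists_realisesCor55Families_of_over`.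
[cite: MochizukiAbsTopIII2015, Cor 5.5 (iii) p. 131] -/
theorem exists_over_of_realisesCor55Families (hK : L.RealisesCor55Families K) :
    ∃ (A : ∀ (v : Vmod) (ν : LogVertex (isArc v)), ν.isPostLog = false → (L.lam v ν ⋙ L.forget v ⋙ L.toE v ≅ L.proj))
      (Ξ : L.log ⋙ L.proj ≅ L.proj),
      (∀ (v : Vmod) (ν₁ ν₂ : LogVertex (isArc v)) (ε : LogEdge (isArc v) ν₁ ν₂) (h₁ : ν₁.isPostLog = false)
        (h₂ : ν₂.isPostLog = false) (X₀ : L.X), (L.toE v).map ((L.forget v).map ((L.iota v ε).app X₀)) ≍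
        ((A v ν₁ h₁).hom.app X₀ ≫ (A v ν₂ h₂).inv.app X₀)) ∧
      (∀ (v : Vmod) (ν₁ ν₂ : LogVertex (isArc v)) (ε : LogEdge (isArc v) ν₁ ν₂) (_ : ν₁.isPostLog = true)
        (h₂ : ν₂.isPostLog = false) (hsl : (LogVertex.spaceLink (isArc v)).isPostLog = false) (X₀ : L.X),
        (L.toE v).map ((L.forget v).map ((L.iota v ε).app X₀)) ≍
        ((A v _ hsl).hom.app (L.log.obj X₀) ≫ Ξ.hom.app X₀ ≫ (A v ν₂ h₂).inv.app X₀)) := by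
  obtain ⟨v₀⟩ := L.nonempty_of_realisesCor55Families hK
  exact ⟨L.overA hK v₀, L.overΞ hK v₀, fun v ν₁ ν₂ ε h₁ h₂ X₀ => L.overA_pre hK v₀ v ν₁ ν₂ ε h₁ h₂ X₀,
    fun v ν₁ ν₂ ε h₁ h₂ hsl X₀ => L.overA_post hK v₀ v ν₁ ν₂ ε h₁ h₂ hsl X₀⟩

end LogFrobeniusSetting

end Literature.AnabelianGeometry.AbsoluteAnabelian
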